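import Literature.Computability.Complexity.AOWListMatrixFP
import Literature.Computability.Complexity.AOWProgram
import HarnessLib

/-!
# The AOW refuter is polynomial time on codes

Trunk T-CPLX-CORE (Literature/Computability/Complexity). Support file for the machine form of the
Allen–O'Donnell–Witmer refuter (running-time third of the discharge of `allen_odonnell_witmer_kSAT`,
`AOWRefutation.lean`): the list program `AOWProg.refuteP k` of `AOWProgram.lean` (which IS the
refuter, `refuteP_eq_aowRefute`) is computed on codes — input `(1ⁿ, code φ)` with the CNF code of
`CNF.lean` (`cnfE = encodingCNF.encode`), output one bit — by a polynomial-time string function: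
**`refutePFP k : CodeFP (pairE unE cnfE) bitE (refuteP k)`**.

The proof assembles the typed combinators of `CodeFP*.lean` and `AOWListMatrixFP.lean` along the
program: clause access (`varAtFP`, `negAtFP`), scope numbers and signs on constant position lists
(`idxLFP`, `sgnLFP`, by recursion on the list), parsing (`parseLFP`), the trace exponent
`q = 2^{aowTraceExp k n}` in unary within the budget `(n + 8k + 8)²` (`qUFP`), the level matrix, its
Gram powers and the level inequality (`levelCheckFP`), the odd matrix / sum of squares and the odd
inequalities (`oddCheckFP`), and the finite conjunction over shapes and injections (`acceptsFP`).

## References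

* S. R. Allen, R. O'Donnell, D. Witmer, *How to refute a random CSP*, FOCS 2015, arXiv:1505.04383,
  Thm. 2.3 ("There is an efficient algorithm …"), App. A.
* S. Arora, B. Barak, *Computational Complexity: A Modern Approach*, CUP 2009, §1.3.
-/

namespace Literature.Computability.Complexity

namespace AOWProg

open _root_.Computability Polynomial Brick CodeFP LMat

/-! ### Codes -/

/-- Literals `(x, b)`: `⟨bin x, [b]⟩` (the `encode` of `encodingLiteral`). [folklore] -/
abbrev litE : Literal ℕ → List Bool := pairE natE bitE

/-- Clauses: headed lists of literals (the `encode` of `encodingClause`). [folklore] -/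
abbrev clauseE : Clause ℕ → List Bool := listE litE

/-- CNFs: headed lists of clauses (the `encode` of `encodingCNF`). [folklore] -/
abbrev cnfE : CNF ℕ → List Bool := listE clauseE

/-- `cnfE` is the tree's CNF encoding. [folklore] -/
theorem cnfE_eq : (encodingCNF.encode : CNF ℕ → List Bool) = cnfE := by
  rw [encodingCNF, listE_eq, encodingClause, listE_eq, encodingLiteral, pairE_eq, natE_eq, bitE_eq]

/-- The working context of the tests: `(n, cs)` with `n` in UNARY and the parsed clauses raw. [folklore] -/
abbrev iE : ℕ × List (Clause ℕ) → List Bool := pairE unE (rawE clauseE)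

/-! ### Clause access, scope numbers, signs -/

/-- The literal at a constant position. [folklore] -/
theorem getDFP (p : ℕ) : CodeFP clauseE litE (fun c => c.getD p (0, false)) :=
  ((rawGetOr litE).comp ((rawOfList litE).pair ((const clauseE p).pair (const clauseE ((0 : ℕ), false))))).congr
    fun _ => rfl

/-- `varAt c p` on codes. [folklore] -/
theorem varAtFP (p : ℕ) : CodeFP clauseE natE (fun c => varAt c p) := (getDFP p).fst'

/-- `negAt c p` on codes. [folklore] -/
theorem negAtFP (p : ℕ) : CodeFP clauseE bitE (fun c => negAt c p) := (getDFP p).snd'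

/-- **Scope numbers on a constant position list** (Horner, by recursion on the list). [folklore] -/
theorem idxLFP : ∀ P : List ℕ, CodeFP (pairE natE clauseE) natE (fun t => idxL t.1 t.2 P)
  | [] => (const _ 0).congr fun _ => rfl
  | p :: P => by
    have hv : CodeFP (pairE natE clauseE) natE (fun t => varAt t.2 p) := (varAtFP p).comp (snd _ _)
    have hm : CodeFP (pairE natE clauseE) natE (fun t => t.1 * idxL t.1 t.2 P) :=
      (natMul.comp ((fst _ _).pair (idxLFP P)) :)
    exact (natAdd.comp (hv.pair hm) :)

/-- `pmSign b · z` as a branch. [folklore] -/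
theorem pmSign_mul_eq_ite (b : Bool) (z : ℤ) : pmSign b * z = if b then z else -z := by
  cases b <;> simp [pmSign]

/-- **Signs on a constant position list.** [folklore] -/
theorem sgnLFP : ∀ S : List ℕ, CodeFP clauseE intE (fun c => sgnL c S)
  | [] => (const _ 1).congr fun _ => rfl
  | p :: S => ((negAtFP p).ite (sgnLFP S) (intNeg.comp (sgnLFP S))).congr fun c => by
      rw [sgnL, pmSign_mul_eq_ite]

/-! ### Parsing -/

/-- The parse condition on codes. [folklore] -/
theorem wfBFP (k : ℕ) : CodeFP (pairE natE clauseE) bitE (fun t => wfB k t.1 t.2) := by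
  have hlen : CodeFP (pairE natE clauseE) bitE (fun t => decide (t.2.length = k)) :=
    (natEq.comp ((((natLength litE).comp ((rawOfList litE).comp (snd _ _)))).pair (const _ k)) :)
  have hlt : CodeFP (pairE natE litE) bitE (fun q => decide (q.2.1 < q.1)) :=
    (natLt.comp ((snd _ _).fst'.pair (fst _ _)) :)
  have hall : CodeFP (pairE natE clauseE) bitE (fun t => t.2.all fun l => decide (l.1 < t.1)) :=
    ((all hlt).comp ((fst _ _).pair ((rawOfList litE).comp (snd _ _)))).congr fun _ => rfl
  exact (hlen.and hall).congr fun _ => rfl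

/-- **Parsing on codes**: `(n, φ) ↦ parseL k n φ`. [folklore] -/
theorem parseLFP (k : ℕ) : CodeFP (pairE natE (rawE clauseE)) (rawE clauseE) (fun t => parseL k t.1 t.2) :=
  (filter (wfBFP k)).congr fun _ => rfl

/-! ### The trace exponent in unary within a polynomial budget -/

/-- The budget `(n + 8k + 8)²` units. [folklore] -/
theorem budgetFP (k : ℕ) : CodeFP unE (rawE unitE) (fun n => List.replicate ((n + (8 * k + 8)) ^ 2) ()) :=
  (unitsPow 2).comp ((unAdd.comp ((CodeFP.id unE).pair (const unE (8 * k + 8)))) :)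

/-- The budget dominates the quantities of the exponent computation. [folklore] -/
theorem budget_bounds (k n : ℕ) :
    n ≤ (n + (8 * k + 8)) ^ 2 ∧ 4 * k * (n + 1) + 1 ≤ (n + (8 * k + 8)) ^ 2 ∧
      8 * k * (n + 1) ≤ (n + (8 * k + 8)) ^ 2 ∧ 16 * k * (n + 1) ≤ (n + (8 * k + 8)) ^ 2 := by
  refine ⟨le_trans (Nat.le_add_right n _) (Nat.le_self_pow two_ne_zero _), ?_, ?_, ?_⟩ <;> nlinarith

/-- `log₂ (4k (log₂ n + 1)) ≤ 4k(n+1)`. [folklore] -/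
theorem log_arg_le (k n : ℕ) : Nat.log 2 (4 * k * (Nat.log 2 n + 1)) ≤ 4 * k * (n + 1) :=
  (Nat.log_le_self 2 _).trans (Nat.mul_le_mul_left _ (Nat.add_le_add_right (Nat.log_le_self 2 n) 1))

/-- **The trace exponent `aowTraceExp k n` on codes**, from `1ⁿ` (two capped logarithm scans within
the budget). [cite: arXiv150504383, App. A.4 (`r = Θ(log n)`)] -/
theorem traceExpFP (k : ℕ) : CodeFP unE natE (fun n => aowTraceExp k n) := by
  have hR := budgetFP k
  have hL₂ : CodeFP unE natE (fun n => Nat.log 2 n) := by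
    refine (natLog2Min.comp (natOfUn.pair hR)).congr fun n => ?_
    dsimp only [id]
    rw [List.length_replicate]
    exact min_eq_right ((Nat.log_le_self 2 n).trans (budget_bounds k n).1)
  have hx : CodeFP unE natE (fun n => 4 * k * (Nat.log 2 n + 1)) :=
    (natMul.comp ((const unE (4 * k)).pair (natAdd.comp (hL₂.pair (const unE 1)))) :)
  refine ((natAdd.comp ((natLog2Min.comp (hx.pair hR)).pair (const unE 1))).congr fun n => ?_)
  dsimp only
  rw [aowTraceExp, List.length_replicate, min_eq_right]
  exact (log_arg_le k n).trans (by have := (budget_bounds k n).2.1; omega)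

/-- **`q = 2^{aowTraceExp k n}` in UNARY** on codes (it is below the budget). [cite: arXiv150504383, App. A.4] -/
theorem qUFP (k : ℕ) : CodeFP unE unE (fun n => 2 ^ aowTraceExp k n) := by
  have hR := budgetFP k
  have hRu : CodeFP unE unE (fun n => (n + (8 * k + 8)) ^ 2) :=
    ((ulength unitE).comp hR).congr fun n => by simp
  -- the exponent in unary
  have hjU : CodeFP unE unE (fun n => aowTraceExp k n) := by
    refine (unOfNatMin.comp (hRu.pair (traceExpFP k))).congr fun n => min_eq_left ?_
    have h1 : aowTraceExp k n ≤ 4 * k * (n + 1) + 1 := Nat.add_le_add_right (log_arg_le k n) 1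
    exact h1.trans (budget_bounds k n).2.1
  have hq : CodeFP unE natE (fun n => 2 ^ aowTraceExp k n) := (natPow.comp ((const unE 2).pair hjU) :)
  refine (unOfNatMin.comp (hRu.pair hq)).congr fun n => min_eq_left ?_
  rcases Nat.eq_zero_or_pos k with rfl | hk
  · simp only [aowTraceExp, mul_zero, zero_mul, Nat.log_zero_right, zero_add, pow_one]
    exact le_trans (by omega) (Nat.le_self_pow two_ne_zero _)
  · exact (two_pow_aowTraceExp_le hk n).trans ((Nat.mul_le_mul_left _ (Nat.add_le_add_right
      (Nat.log_le_self 2 n) 1)).trans (budget_bounds k n).2.2.1)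

/-- Powers of the unary `n`: `1ⁿ ↦ 1^{n^c}`. [folklore] -/
theorem powUFP (c : ℕ) : CodeFP unE unE (fun n => n ^ c) :=
  ((ulength unitE).comp (unitsPow c)).congr fun n => by simp

/-! ### The level test on codes -/

section Level

variable (P₁ P₂ S : List ℕ)

/-- The context of an entry computation: `(n, (x, y))`, and the clause. [folklore] -/
abbrev eCtxE : (ℕ × (ℕ × ℕ)) × Clause ℕ → List Bool := pairE (pairE natE (pairE natE natE)) clauseE

/-- The per-clause term of `bEnt` on codes. [folklore] -/
theorem bTermFP : CodeFP eCtxE intE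
    (fun q => if idxL q.1.1 q.2 P₁ = q.1.2.1 ∧ idxL q.1.1 q.2 P₂ = q.1.2.2 then sgnL q.2 S else 0) := by
  have hi₁ : CodeFP eCtxE natE (fun q => idxL q.1.1 q.2 P₁) := (idxLFP P₁).comp ((fst _ _).fst'.pair (snd _ _))
  have hi₂ : CodeFP eCtxE natE (fun q => idxL q.1.1 q.2 P₂) := (idxLFP P₂).comp ((fst _ _).fst'.pair (snd _ _))
  have hc : CodeFP eCtxE bitE (fun q => decide (idxL q.1.1 q.2 P₁ = q.1.2.1) && decide (idxL q.1.1 q.2 P₂ = q.1.2.2)) :=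
    ((natEq.comp (hi₁.pair (fst _ _).snd'.fst') :).and (natEq.comp (hi₂.pair (fst _ _).snd'.snd') :))
  exact (hc.ite ((sgnLFP S).comp (snd _ _)) (const _ 0)).congr fun q => by
    simp only [Bool.and_eq_true, decide_eq_true_eq]

/-- **Entries of the level matrix on codes**: context `(n, cs)` (unary `n`), variables `(x, y)`. [cite: arXiv150504383, App. A] -/
theorem bEntFP : CodeFP (pairE iE (pairE natE natE)) intE (fun t => bEnt t.1.1 t.1.2 P₁ P₂ S t.2.1 t.2.2) := by
  have hsum := intSum.comp (map (bTermFP P₁ P₂ S))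
  have hn : CodeFP (pairE iE (pairE natE natE)) natE (fun t => t.1.1) := (natOfUn.comp (fst _ _).fst' :)
  exact (hsum.comp ((hn.pair (snd _ _)).pair (fst _ _).snd')).congr fun _ => rfl

/-- **The level matrix on codes.** [cite: arXiv150504383, App. A] -/
theorem bMatFP (a b : ℕ) : CodeFP iE matE (fun t => bMat t.1 a b t.2 P₁ P₂ S) :=
  ((tabFP (bEntFP P₁ P₂ S)).comp ((CodeFP.id iE).pair (((powUFP a).comp (fst _ _)).pair
    ((powUFP b).comp (fst _ _))))).congr fun _ => rfl

/-- **The level trace `tr((BᵀB)^q)` on codes**, `q` in unary. [cite: arXiv150504383, App. A.4] -/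
theorem levelTraceFP (a b : ℕ) :
    CodeFP (pairE iE unE) intE (fun t => levelTraceP t.1.1 a b t.2 t.1.2 P₁ P₂ S) := by
  have hB : CodeFP (pairE iE unE) matE (fun t => bMat t.1.1 a b t.1.2 P₁ P₂ S) := (bMatFP P₁ P₂ S a b).comp (fst _ _)
  have hNa : CodeFP (pairE iE unE) unE (fun t => t.1.1 ^ a) := (powUFP a).comp (fst _ _).fst'
  have hNb : CodeFP (pairE iE unE) unE (fun t => t.1.1 ^ b) := (powUFP b).comp (fst _ _).fst'
  have hG : CodeFP (pairE iE unE) matE (fun t => gramL (t.1.1 ^ a) (t.1.1 ^ b) (bMat t.1.1 a b t.1.2 P₁ P₂ S)) :=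
    (gramLFP.comp ((hNa.pair hNb).pair hB) :)
  have hP : CodeFP (pairE iE unE) matE
      (fun t => powL (t.1.1 ^ b) (gramL (t.1.1 ^ a) (t.1.1 ^ b) (bMat t.1.1 a b t.1.2 P₁ P₂ S)) t.2) :=
    (powLFP.comp (hNb.pair (hG.pair (snd _ _))) :)
  exact ((traceLFP.comp (hNb.pair hP) :)).congr fun _ => rfl

/-- **The level test on codes**: `((n, cs), q) ↦ [LevelCheckP k n a b q |cs| cs …]`. [cite: arXiv150504383, App. A] -/
theorem levelCheckFP (k a b : ℕ) :
    CodeFP (pairE iE unE) bitE (fun t => decide (LevelCheckP k t.1.1 a b t.2 t.1.2.length t.1.2 P₁ P₂ S)) := by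
  have hq : CodeFP (pairE iE unE) unE (fun t => t.2) := snd _ _
  have h2q : CodeFP (pairE iE unE) unE (fun t => 2 * t.2) := (unAdd.comp (hq.pair hq)).congr fun t => by dsimp only; omega
  have hA : CodeFP (pairE iE unE) intE (fun t => ((2 : ℤ) ^ k) ^ (2 * t.2)) := (intPow.comp ((const _ ((2 : ℤ) ^ k)).pair h2q) :)
  have hn : CodeFP (pairE iE unE) intE (fun t => (t.1.1 : ℤ)) := (intOfNat.comp (natOfUn.comp (fst _ _).fst') :)
  have hna : CodeFP (pairE iE unE) intE (fun t => ((t.1.1 : ℤ) ^ a) ^ t.2) :=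
    (intPow.comp ((intPow.comp (hn.pair (const _ a)) :).pair hq) :)
  have hnb : CodeFP (pairE iE unE) intE (fun t => ((t.1.1 : ℤ) ^ b) ^ t.2) :=
    (intPow.comp ((intPow.comp (hn.pair (const _ b)) :).pair hq) :)
  have hm : CodeFP (pairE iE unE) intE (fun t => (t.1.2.length : ℤ)) :=
    (intOfNat.comp ((natLength clauseE).comp (fst _ _).snd') :)
  have hR : CodeFP (pairE iE unE) intE (fun t => (t.1.2.length : ℤ) ^ (2 * t.2)) := (intPow.comp (hm.pair h2q) :)
  have hT := levelTraceFP P₁ P₂ S a b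
  have hL : CodeFP (pairE iE unE) intE (fun t => ((2 : ℤ) ^ k) ^ (2 * t.2) *
      (((t.1.1 : ℤ) ^ a) ^ t.2 * ((t.1.1 : ℤ) ^ b) ^ t.2 * levelTraceP t.1.1 a b t.2 t.1.2 P₁ P₂ S)) :=
    (intMul.comp (hA.pair (intMul.comp ((intMul.comp (hna.pair hnb) :).pair hT) :)) :)
  exact ((intLt.comp (hL.pair hR) :)).congr fun _ => rfl

end Level

/-! ### The odd test on codes -/

section Odd

variable (P₁ P₂ : List ℕ) (pl : ℕ) (S : List ℕ)

/-- The context of a tensor-entry computation: `(n, (x, (y, l)))`, and the clause. [folklore] -/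
abbrev wCtxE : (ℕ × (ℕ × (ℕ × ℕ))) × Clause ℕ → List Bool :=
  pairE (pairE natE (pairE natE (pairE natE natE))) clauseE

/-- The per-clause term of `wEnt` on codes. [folklore] -/
theorem wTermFP : CodeFP wCtxE intE
    (fun q => if idxL q.1.1 q.2 P₁ = q.1.2.1 ∧ idxL q.1.1 q.2 P₂ = q.1.2.2.1 ∧ varAt q.2 pl = q.1.2.2.2
      then sgnL q.2 S else 0) := by
  have hi₁ : CodeFP wCtxE natE (fun q => idxL q.1.1 q.2 P₁) := (idxLFP P₁).comp ((fst _ _).fst'.pair (snd _ _))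
  have hi₂ : CodeFP wCtxE natE (fun q => idxL q.1.1 q.2 P₂) := (idxLFP P₂).comp ((fst _ _).fst'.pair (snd _ _))
  have hv : CodeFP wCtxE natE (fun q => varAt q.2 pl) := (varAtFP pl).comp (snd _ _)
  have hc₁ : CodeFP wCtxE bitE (fun q => decide (idxL q.1.1 q.2 P₁ = q.1.2.1)) :=
    (natEq.comp (hi₁.pair (fst _ _).snd'.fst') :)
  have hc₂ : CodeFP wCtxE bitE (fun q => decide (idxL q.1.1 q.2 P₂ = q.1.2.2.1)) :=
    (natEq.comp (hi₂.pair (fst _ _).snd'.snd'.fst') :)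
  have hc₃ : CodeFP wCtxE bitE (fun q => decide (varAt q.2 pl = q.1.2.2.2)) :=
    (natEq.comp (hv.pair (fst _ _).snd'.snd'.snd') :)
  exact ((hc₁.and (hc₂.and hc₃)).ite ((sgnLFP S).comp (snd _ _)) (const _ 0)).congr fun q => by
    simp only [Bool.and_eq_true, decide_eq_true_eq]

/-- **Entries of the tensor on codes**: context `(n, cs)`, variables `(x, (y, l))`. [cite: arXiv150504383, App. A.2] -/
theorem wEntFP : CodeFP (pairE iE (pairE natE (pairE natE natE))) intE
    (fun t => wEnt t.1.1 t.1.2 P₁ P₂ pl S t.2.1 t.2.2.1 t.2.2.2) := by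
  have hsum := intSum.comp (map (wTermFP P₁ P₂ pl S))
  have hn : CodeFP (pairE iE (pairE natE (pairE natE natE))) natE (fun t => t.1.1) := (natOfUn.comp (fst _ _).fst' :)
  exact (hsum.comp ((hn.pair (snd _ _)).pair (fst _ _).snd')).congr fun _ => rfl

/-- The context of an odd-matrix entry: `((n, cs), (ρ, κ))`. [folklore] -/
abbrev aCtxE : (ℕ × List (Clause ℕ)) × (ℕ × ℕ) → List Bool := pairE iE (pairE natE natE)

/-- **Entries of the odd matrix on codes.** [cite: arXiv150504383, App. A.2] -/
theorem aEntFP (r : ℕ) : CodeFP aCtxE intE (fun t => aEnt t.1.1 r t.1.2 P₁ P₂ pl S t.2.1 t.2.2) := by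
  have hN : CodeFP aCtxE natE (fun t => t.1.1 ^ r) := (natPow.comp ((natOfUn.comp (fst _ _).fst').pair (const _ r)) :)
  have hρd : CodeFP aCtxE natE (fun t => t.2.1 / t.1.1 ^ r) := (natDiv.comp ((snd _ _).fst'.pair hN) :)
  have hρm : CodeFP aCtxE natE (fun t => t.2.1 % t.1.1 ^ r) := (natMod.comp ((snd _ _).fst'.pair hN) :)
  have hκd : CodeFP aCtxE natE (fun t => t.2.2 / t.1.1 ^ r) := (natDiv.comp ((snd _ _).snd'.pair hN) :)
  have hκm : CodeFP aCtxE natE (fun t => t.2.2 % t.1.1 ^ r) := (natMod.comp ((snd _ _).snd'.pair hN) :)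
  have hcond : CodeFP aCtxE bitE (fun t => decide (t.2.1 / t.1.1 ^ r = t.2.1 % t.1.1 ^ r) &&
      decide (t.2.2 / t.1.1 ^ r = t.2.2 % t.1.1 ^ r)) :=
    ((natEq.comp (hρd.pair hρm) :).and (natEq.comp (hκd.pair hκm) :))
  -- the summand, context `t`, variable `l`
  have hw := wEntFP P₁ P₂ pl S
  have hw₁ : CodeFP (pairE aCtxE natE) intE (fun p =>
      wEnt p.1.1.1 p.1.1.2 P₁ P₂ pl S (p.1.2.1 / p.1.1.1 ^ r) (p.1.2.2 / p.1.1.1 ^ r) p.2) :=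
    (hw.comp ((fst _ _).fst'.pair ((hρd.comp (fst _ _)).pair ((hκd.comp (fst _ _)).pair (snd _ _)))) :)
  have hw₂ : CodeFP (pairE aCtxE natE) intE (fun p =>
      wEnt p.1.1.1 p.1.1.2 P₁ P₂ pl S (p.1.2.1 % p.1.1.1 ^ r) (p.1.2.2 % p.1.1.1 ^ r) p.2) :=
    (hw.comp ((fst _ _).fst'.pair ((hρm.comp (fst _ _)).pair ((hκm.comp (fst _ _)).pair (snd _ _)))) :)
  have hf : CodeFP (pairE aCtxE natE) intE (fun p =>
      wEnt p.1.1.1 p.1.1.2 P₁ P₂ pl S (p.1.2.1 / p.1.1.1 ^ r) (p.1.2.2 / p.1.1.1 ^ r) p.2 *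
        wEnt p.1.1.1 p.1.1.2 P₁ P₂ pl S (p.1.2.1 % p.1.1.1 ^ r) (p.1.2.2 % p.1.1.1 ^ r) p.2) :=
    (intMul.comp (hw₁.pair hw₂) :)
  have hs : CodeFP aCtxE intE (fun t => sumRange t.1.1 fun l =>
      wEnt t.1.1 t.1.2 P₁ P₂ pl S (t.2.1 / t.1.1 ^ r) (t.2.2 / t.1.1 ^ r) l *
        wEnt t.1.1 t.1.2 P₁ P₂ pl S (t.2.1 % t.1.1 ^ r) (t.2.2 % t.1.1 ^ r) l) :=
    ((sumRangeFP hf).comp ((CodeFP.id aCtxE).pair (fst _ _).fst') :)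
  exact (hcond.ite (const _ 0) hs).congr fun t => by
    simp only [aEnt, Bool.and_eq_true, decide_eq_true_eq]

/-- **The odd matrix on codes** (`N² × N²`, `N = n^r`). [cite: arXiv150504383, App. A.2] -/
theorem aMatFP (r : ℕ) : CodeFP iE matE (fun t => aMat t.1 r t.2 P₁ P₂ pl S) := by
  have hNN : CodeFP iE unE (fun t => t.1 ^ r * t.1 ^ r) := ((powUFP (r + r)).comp (fst _ _)).congr fun t => by
    rw [pow_add]
  exact ((tabFP (aEntFP P₁ P₂ pl S r)).comp ((CodeFP.id iE).pair (hNN.pair hNN))).congr fun _ => rfl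

/-- **The odd trace `tr((AᵀA)^q)` on codes**, `q` in unary. [cite: arXiv150504383, App. A.4] -/
theorem oddTraceFP (r : ℕ) :
    CodeFP (pairE iE unE) intE (fun t => oddTraceP t.1.1 r t.2 t.1.2 P₁ P₂ pl S) := by
  have hA : CodeFP (pairE iE unE) matE (fun t => aMat t.1.1 r t.1.2 P₁ P₂ pl S) := (aMatFP P₁ P₂ pl S r).comp (fst _ _)
  have hNN : CodeFP (pairE iE unE) unE (fun t => t.1.1 ^ r * t.1.1 ^ r) :=
    ((powUFP (r + r)).comp (fst _ _).fst').congr fun t => by rw [pow_add]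
  have hG : CodeFP (pairE iE unE) matE (fun t => gramL (t.1.1 ^ r * t.1.1 ^ r) (t.1.1 ^ r * t.1.1 ^ r)
      (aMat t.1.1 r t.1.2 P₁ P₂ pl S)) :=
    (gramLFP.comp ((hNN.pair hNN).pair hA) :)
  have hP : CodeFP (pairE iE unE) matE (fun t => powL (t.1.1 ^ r * t.1.1 ^ r)
      (gramL (t.1.1 ^ r * t.1.1 ^ r) (t.1.1 ^ r * t.1.1 ^ r) (aMat t.1.1 r t.1.2 P₁ P₂ pl S)) t.2) :=
    (powLFP.comp (hNN.pair (hG.pair (snd _ _))) :)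
  exact ((traceLFP.comp (hNN.pair hP) :)).congr fun _ => rfl

/-- **The sum of squares `∑ w²` on codes.** [cite: arXiv150504383, App. A.2] -/
theorem sqSumFP (r : ℕ) : CodeFP iE intE (fun t => sqSumP t.1 r t.2 P₁ P₂ pl S) := by
  have hw := wEntFP P₁ P₂ pl S
  -- innermost: context `((n, cs), (x, y))`, variable `l`
  have hf₃ : CodeFP (pairE aCtxE natE) intE (fun p => wEnt p.1.1.1 p.1.1.2 P₁ P₂ pl S p.1.2.1 p.1.2.2 p.2 ^ 2) := by
    have hw' : CodeFP (pairE aCtxE natE) intE (fun p => wEnt p.1.1.1 p.1.1.2 P₁ P₂ pl S p.1.2.1 p.1.2.2 p.2) :=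
      (hw.comp ((fst _ _).fst'.pair ((fst _ _).snd'.fst'.pair ((fst _ _).snd'.snd'.pair (snd _ _)))) :)
    exact ((intMul.comp (hw'.pair hw') :)).congr fun p => by rw [sq]
  have hS₃ : CodeFP aCtxE intE (fun u => sumRange u.1.1 fun l => wEnt u.1.1 u.1.2 P₁ P₂ pl S u.2.1 u.2.2 l ^ 2) :=
    ((sumRangeFP hf₃).comp ((CodeFP.id aCtxE).pair (fst _ _).fst') :)
  -- middle: context `((n, cs), x)`, variable `y`
  have hf₂ : CodeFP (pairE (pairE iE natE) natE) intE
      (fun p => sumRange p.1.1.1 fun l => wEnt p.1.1.1 p.1.1.2 P₁ P₂ pl S p.1.2 p.2 l ^ 2) :=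
    (hS₃.comp ((fst _ _).fst'.pair ((fst _ _).snd'.pair (snd _ _))) :)
  have hS₂ : CodeFP (pairE iE natE) intE (fun u => sumRange (u.1.1 ^ r) fun y =>
      sumRange u.1.1 fun l => wEnt u.1.1 u.1.2 P₁ P₂ pl S u.2 y l ^ 2) :=
    ((sumRangeFP hf₂).comp ((CodeFP.id _).pair ((powUFP r).comp (fst _ _).fst')) :)
  -- outer: context `(n, cs)`, variable `x`
  exact (((sumRangeFP hS₂).comp ((CodeFP.id iE).pair ((powUFP r).comp (fst _ _))) :)).congr fun _ => rfl

/-- **The odd test on codes**: `((n, cs), q) ↦ [OddCheckP k n r q |cs| cs …]`. [cite: arXiv150504383, App. A.2] -/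
theorem oddCheckFP (k r : ℕ) :
    CodeFP (pairE iE unE) bitE (fun t => decide (OddCheckP k t.1.1 r t.2 t.1.2.length t.1.2 P₁ P₂ pl S)) := by
  have hq : CodeFP (pairE iE unE) unE (fun t => t.2) := snd _ _
  have h2q : CodeFP (pairE iE unE) unE (fun t => 2 * t.2) := (unAdd.comp (hq.pair hq)).congr fun t => by dsimp only; omega
  have hn : CodeFP (pairE iE unE) intE (fun t => (t.1.1 : ℤ)) := (intOfNat.comp (natOfUn.comp (fst _ _).fst') :)
  have hc₁ : CodeFP (pairE iE unE) intE (fun t => 2 * 4 ^ k * (t.1.1 : ℤ)) :=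
    (intMul.comp ((const _ (2 * 4 ^ k : ℤ)).pair hn) :)
  have hA : CodeFP (pairE iE unE) intE (fun t => (2 * 4 ^ k * (t.1.1 : ℤ)) ^ (2 * t.2)) := (intPow.comp (hc₁.pair h2q) :)
  have hnr : CodeFP (pairE iE unE) intE (fun t => (((t.1.1 : ℤ) ^ r) ^ 2) ^ t.2) :=
    (intPow.comp ((intPow.comp ((intPow.comp (hn.pair (const _ r)) :).pair (const _ 2)) :).pair hq) :)
  have hm : CodeFP (pairE iE unE) intE (fun t => (t.1.2.length : ℤ)) :=
    (intOfNat.comp ((natLength clauseE).comp (fst _ _).snd') :)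
  have hm2 : CodeFP (pairE iE unE) intE (fun t => (t.1.2.length : ℤ) ^ 2) := (intPow.comp (hm.pair (const _ 2)) :)
  have hR₁ : CodeFP (pairE iE unE) intE (fun t => ((t.1.2.length : ℤ) ^ 2) ^ (2 * t.2)) := (intPow.comp (hm2.pair h2q) :)
  have hT := oddTraceFP P₁ P₂ pl S r
  have hL₁ : CodeFP (pairE iE unE) intE (fun t => (2 * 4 ^ k * (t.1.1 : ℤ)) ^ (2 * t.2) *
      ((((t.1.1 : ℤ) ^ r) ^ 2) ^ t.2 * (((t.1.1 : ℤ) ^ r) ^ 2) ^ t.2 * oddTraceP t.1.1 r t.2 t.1.2 P₁ P₂ pl S)) :=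
    (intMul.comp (hA.pair (intMul.comp ((intMul.comp (hnr.pair hnr) :).pair hT) :)) :)
  have hSq : CodeFP (pairE iE unE) intE (fun t => sqSumP t.1.1 r t.1.2 P₁ P₂ pl S) := (sqSumFP P₁ P₂ pl S r).comp (fst _ _)
  have hL₂ : CodeFP (pairE iE unE) intE (fun t => 2 * 4 ^ k * (t.1.1 : ℤ) * sqSumP t.1.1 r t.1.2 P₁ P₂ pl S) :=
    (intMul.comp (hc₁.pair hSq) :)
  exact (((intLt.comp (hL₁.pair hR₁) :).and (intLt.comp (hL₂.pair hm2) :))).congr fun t => by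
    unfold OddCheckP
    rw [Bool.decide_and]

end Odd

/-! ### The whole test and the refuter on codes -/

/-- `decide` of an implication from a true hypothesis. [folklore] -/
theorem decide_imp_of_pos {A B : Prop} [Decidable (A → B)] [Decidable B] (h : A) : decide (A → B) = decide B := by
  rw [Bool.eq_iff_iff, decide_eq_true_iff, decide_eq_true_iff]
  exact ⟨fun f => f h, fun b _ => b⟩

/-- `decide` of an implication from a false hypothesis. [folklore] -/
theorem decide_imp_of_neg {A B : Prop} [Decidable (A → B)] (h : ¬ A) : decide (A → B) = true :=
  decide_eq_true fun a => absurd a h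

/-- `decide` does not depend on the decidability instance. [folklore] -/
theorem decide_congr_inst {P : Prop} (i₁ i₂ : Decidable P) : @decide P i₁ = @decide P i₂ := by
  congr

/-- **The level conjuncts on codes**, one shape `(a, b)` and one map `g` at a time (the hypotheses on
the index are constants). [cite: arXiv150504383, Thm. 2.3] -/
theorem levelFamilyFP (k : ℕ) : CodeFP (pairE iE unE) bitE (fun t => decide
    (∀ a b : Fin (k + 1), IsBalancedShape k a b → ∀ g : Fin (a + b) → Fin k, Function.Injective g →
      LevelCheckP k t.1.1 a b t.2 t.1.2.length t.1.2 (pos₁ g) (pos₂ g) (posS g))) := by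
  refine (decideForallFintype (P := fun (a : Fin (k + 1)) (t : (ℕ × List (Clause ℕ)) × ℕ) => ∀ b : Fin (k + 1),
    IsBalancedShape k a b → ∀ g : Fin (a + b) → Fin k, Function.Injective g →
      LevelCheckP k t.1.1 a b t.2 t.1.2.length t.1.2 (pos₁ g) (pos₂ g) (posS g)) fun a => ?_).congr
    fun t => decide_congr_inst _ _
  refine (decideForallFintype (P := fun (b : Fin (k + 1)) (t : (ℕ × List (Clause ℕ)) × ℕ) => IsBalancedShape k a b →
    ∀ g : Fin (a + b) → Fin k, Function.Injective g →
      LevelCheckP k t.1.1 a b t.2 t.1.2.length t.1.2 (pos₁ g) (pos₂ g) (posS g)) fun b => ?_).congr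
    fun t => decide_congr_inst _ _
  by_cases hs : IsBalancedShape k a b
  · refine (decideForallFintype (P := fun (g : Fin (a + b) → Fin k) (t : (ℕ × List (Clause ℕ)) × ℕ) => Function.Injective g →
      LevelCheckP k t.1.1 a b t.2 t.1.2.length t.1.2 (pos₁ g) (pos₂ g) (posS g)) fun g => ?_).congr fun t => ?_
    · by_cases hg : Function.Injective g
      · exact (levelCheckFP (pos₁ g) (pos₂ g) (posS g) k a b).congr fun t => (decide_imp_of_pos hg).symm
      · exact (const _ true).congr fun t => (decide_imp_of_neg hg).symm
    · exact ((decide_congr_inst _ _).trans (decide_imp_of_pos hs)).symm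
  · exact (const _ true).congr fun t => (decide_imp_of_neg hs).symm

/-- **The odd conjuncts on codes.** [cite: arXiv150504383, Thm. 2.3] -/
theorem oddFamilyFP (k : ℕ) : CodeFP (pairE iE unE) bitE (fun t => decide
    (∀ g : Fin (k / 2 + k / 2 + 1) → Fin k, Function.Injective g →
      OddCheckP k t.1.1 (k / 2) t.2 t.1.2.length t.1.2 (opos₁ g) (opos₂ g) (oposLast g) (posS g))) := by
  refine (decideForallFintype (P := fun (g : Fin (k / 2 + k / 2 + 1) → Fin k) (t : (ℕ × List (Clause ℕ)) × ℕ) =>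
    Function.Injective g →
      OddCheckP k t.1.1 (k / 2) t.2 t.1.2.length t.1.2 (opos₁ g) (opos₂ g) (oposLast g) (posS g)) fun g => ?_).congr
    fun t => decide_congr_inst _ _
  by_cases hg : Function.Injective g
  · exact (oddCheckFP (opos₁ g) (opos₂ g) (oposLast g) (posS g) k (k / 2)).congr fun t => (decide_imp_of_pos hg).symm
  · exact (const _ true).congr fun t => (decide_imp_of_neg hg).symm

/-- **The acceptance test on codes**: `((n, cs), q) ↦ [AcceptsP k n q cs]`. [cite: arXiv150504383, Thm. 2.3] -/
theorem acceptsFP (k : ℕ) : CodeFP (pairE iE unE) bitE (fun t => decide (AcceptsP k t.1.1 t.2 t.1.2)) :=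
  ((levelFamilyFP k).and (oddFamilyFP k)).congr fun t => by
    rw [Bool.eq_iff_iff, Bool.and_eq_true, decide_eq_true_iff, decide_eq_true_iff, decide_eq_true_iff]
    exact Iff.rfl

/-- **The AOW refuter is polynomial time on codes**: `refuteP k`, from `(1ⁿ, code φ)` to one bit, is
computed by a polynomial-time string function. [Allen–O'Donnell–Witmer 2015, Thm. 2.3 ("There is
an efficient algorithm")] [cite: arXiv150504383, Thm. 2.3] -/
theorem refutePFP (k : ℕ) : CodeFP (pairE unE cnfE) bitE (refuteP k) := by
  have hcs : CodeFP (pairE unE cnfE) (rawE clauseE) (fun p => parseL k p.1 p.2) :=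
    ((parseLFP k).comp ((natOfUn.comp (fst _ _)).pair ((rawOfList clauseE).comp (snd _ _)))).congr fun _ => rfl
  have hq : CodeFP (pairE unE cnfE) unE (fun p => 2 ^ aowTraceExp k p.1) := (qUFP k).comp (fst _ _)
  exact ((acceptsFP k).comp (((fst _ _).pair hcs).pair hq)).congr fun _ => rfl

/-- **The refuter between the tree's encodings**: some `F ∈ FP` maps
`boolPair (unaryEncodeNat n) (encodingCNF.encode φ)` to `[aowRefute k n φ]`. [cite: arXiv150504383, Thm. 2.3] -/
theorem exists_fp_aowRefute (k : ℕ) : ∃ F ∈ FP, ∀ (n : ℕ) (φ : CNF ℕ),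
    F (boolPair (unaryEncodeNat n) (encodingCNF.encode φ)) = [aowRefute k n φ] := by
  obtain ⟨F, hF, hFr⟩ := refutePFP k
  refine ⟨F, hF, fun n φ => ?_⟩
  have := hFr (n, φ)
  rw [pairE_apply, refuteP_eq_aowRefute] at this
  rw [cnfE_eq]
  exact this

end AOWProg

end Literature.Computability.Complexity
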